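import Literature.Probability.Percolation.SiteIfaceWalk
import Literature.Probability.Percolation.SiteIfaceWinding
import Literature.Probability.LatticeModels.TriMeshLattice
import HarnessLib

/-!
# The interface walk inside a cycle; the hexagonal rings; sector cycles (colour-switching, II)

Topic `Literature/Probability/Percolation`; family `crit-perc`. The planar-topological tools of
the colour-exchange flip in an annulus (P. Nolin, Electron. J. Probab. **13** (2008), §5.1,
proof of Prop. 20 [arXiv 0711.4948: Prop. 19]; S. Smirnov, W. Werner, Math. Res. Lett. **8**
(2001), §4; after Bollobás–Riordan, *Percolation* (2006), Ch. 7, Claims 7 and 9, pp. 173–175: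
"exactly two edges of the interface graph `I` cross `C` …"; "`P₃` cannot cross `C`"), for the
site-coloured interface walk of `SiteIfaceWalk.lean` and the winding numbers of
`TriLoopWinding.lean` / `SiteIfaceWinding.lean`:

* `SiteIface.latWind_walk_eq` / `latWind_walk_one_ne` — **the walk stays inside**: for a closed
  lattice polyline one of whose pieces is the first crossed side `e⃗` (once) and all of whose
  other pieces join sites of equal colour or a grey site, every face of the walk after the start
  has the winding number of the first face, which differs from that of the start face;
* `ringPt k i` — **the `i`-th site of the hexagon `∂Λ_k` in anticlockwise order** from the corner
  `(k, -k)` (sides `x₀ = k`, `x₀ + x₁ = k`, `x₁ = k`, `x₀ = -k`, `x₀ + x₁ = -k`, `x₁ = -k`), with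
  its coordinates (`ringPt_spec`), norm, adjacency of consecutive sites, injectivity, and the sign
  of `2x₀ + x₁` along it (positive exactly up to the index `ringMid k` in the middle of the side
  `x₁ = k`);
* `SectorCycle` — **the cycle of a sector of an annulus**: an arm `P` from `a` to `b`, the bond to
  a ring site `ringPt K i₁`, the arc of the ring `∂Λ_K` up to `ringPt K i₂`, the bond to `b'`, an
  arm `Q` backwards from `b'` to `a'`, and a closing path `I` through the hole; its pieces
  (`latPieces_eq`, `mem_latPieces`), that they are bonds or points, the bound on its vertices
  (hence `W_triEmbed_eq_zero_of_lt`: no winding about sites beyond the ring), which sites are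
  vertices (`ne_of_mem_latPieces`), the arc piece at `ringMid` singled out (`latPieces_eq_mid`,
  `ne_mid_of_mem_rest`) and the colours of the other pieces (`colours_of_mem_latPieces`).

Everything is proved; no events and no named facts are introduced.

## References

* B. Bollobás, O. Riordan, *Percolation*, Cambridge University Press (2006), Ch. 7 §7.2.3,
  Claims 7 and 9, pp. 173–175 [BollobasRiordan2006].
* P. Nolin, *Near-critical percolation in two dimensions*, Electron. J. Probab. 13 (2008), §5.1
  Prop. 20 (arXiv 0711.4948: Prop. 19) [Nolin2008].
* S. Smirnov, W. Werner, Math. Res. Lett. 8 (2001) 729–744, §4 [SmirnovWernerMRL2001].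

## Mathlib / tree

Tree: `SiteIfaceWalk.lean` (the walk), `SiteIfaceWinding.lean`, `TriLoopWinding.lean`
(`latWind_hexCenter_eq_of_forall_not_side`, `latWind_hexCenter_ne_of_side`, `latPieces`,
`consecPairs_append_of_ne_nil`, `adj_of_mem_consecPairs_support`), `triGraph_adj_iff_coord'`,
`site2_ext'` (`TriMeshLattice.lean`), `triNorm_eq_of_apply_eq`, `CyclicPairs.lean`.
-/

noncomputable section

open Finset Literature.Combinatorics.Enumerative

namespace Literature.Probability.Percolation

open LatticeModels
open TriMarkedDomain (fin3_add_one_add_one fin3_add_one_add_two fin3_add_two_add_one fin3_add_two_add_two)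

/-! ### The walk stays inside a cycle crossed only along the first side -/

namespace SiteIface

variable {c : Site 2 → Option Bool} {F₀ : HexVertex} {j₀ : Fin 3} {v₀ : Site 2} {l : List (Site 2)}

/-- **An interface step across a side which is not a piece keeps the winding number; the only
piece that is an interface side is the first crossed side, crossed at step `0` only.** Hence all
faces of the walk after the start have the winding number of the first face
(Bollobás–Riordan 2006, p. 174: "exactly two edges of the interface graph `I` cross `C`, the edge
`e⃗` … and an edge `yy′`"). [cite: BollobasRiordan2006, Ch. 7 proof of Claim 7 p. 174] -/
theorem latWind_walk_eq (h : ∃ t, next c (walk c F₀ t) = none) (h₀ : ∀ j, ¬ IsEntry c F₀ j) (hX₀ : IsExit c F₀ j₀)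
    (hadj : ∀ p ∈ latPieces v₀ l, p.1 = p.2 ∨ triGraph.Adj p.1 p.2)
    (hmono : ∀ p ∈ latPieces v₀ l,
      ¬ ((p.1 = faceVertex F₀ (j₀ + 1) ∧ p.2 = faceVertex F₀ (j₀ + 2)) ∨ (p.1 = faceVertex F₀ (j₀ + 2) ∧ p.2 = faceVertex F₀ (j₀ + 1))) →
        ∀ b₁ b₂, c p.1 = some b₁ → c p.2 = some b₂ → b₁ = b₂)
    {t : ℕ} (h1 : 1 ≤ t) (ht : t ≤ len c F₀) :
    latWind v₀ l (hexCenter (walk c F₀ t)) = latWind v₀ l (hexCenter (walk c F₀ 1)) := by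
  induction t with
  | zero => exact absurd h1 (by norm_num)
  | succ t ih =>
    rcases Nat.eq_zero_or_pos t with rfl | htpos
    · rfl
    · have htlt : t < len c F₀ := ht
      rw [← ih htpos htlt.le]
      obtain ⟨j, hj, he⟩ := next_eq_some (next_walk_of_lt h htlt)
      rw [walk_succ_eq_of_isExit h htlt hj]
      refine (latWind_hexCenter_eq_of_forall_not_side hadj fun p hp hside => ?_).symm
      by_cases hp0 : (p.1 = faceVertex F₀ (j₀ + 1) ∧ p.2 = faceVertex F₀ (j₀ + 2)) ∨
          (p.1 = faceVertex F₀ (j₀ + 2) ∧ p.2 = faceVertex F₀ (j₀ + 1))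
      · -- the side is the first side: only crossed at step `0`
        have hs : (faceVertex (walk c F₀ t) (j + 1) = faceVertex F₀ (j₀ + 1) ∧ faceVertex (walk c F₀ t) (j + 2) = faceVertex F₀ (j₀ + 2)) ∨
            (faceVertex (walk c F₀ t) (j + 1) = faceVertex F₀ (j₀ + 2) ∧ faceVertex (walk c F₀ t) (j + 2) = faceVertex F₀ (j₀ + 1)) := by
          rcases hside with ⟨h1', h2'⟩ | ⟨h1', h2'⟩ <;> rcases hp0 with ⟨q1, q2⟩ | ⟨q1, q2⟩
          · exact Or.inl ⟨h1'.symm.trans q1, h2'.symm.trans q2⟩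
          · exact Or.inr ⟨h1'.symm.trans q1, h2'.symm.trans q2⟩
          · exact Or.inr ⟨h2'.symm.trans q2, h1'.symm.trans q1⟩
          · exact Or.inl ⟨h2'.symm.trans q2, h1'.symm.trans q1⟩
        have := eq_zero_of_cross_start_side h h₀ hX₀ htlt hj hs
        omega
      · -- another piece: its endpoints have equal colours, the side's do not
        obtain ⟨hf, ht'⟩ := hj
        rcases hside with ⟨h1', h2'⟩ | ⟨h1', h2'⟩
        · have := hmono p hp hp0 false true (by rw [h1']; exact hf) (by rw [h2']; exact ht')
          exact absurd this (by decide)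
        · have := hmono p hp hp0 true false (by rw [h1']; exact ht') (by rw [h2']; exact hf)
          exact absurd this (by decide)

/-- **Crossing the first side changes the winding number**: if the first crossed side is a piece
of the polyline, traversed once, the first face and the start face have different winding
numbers. [cite: BollobasRiordan2006, Ch. 7 proof of Claim 7 p. 174] -/
theorem latWind_walk_one_ne (hX₀ : IsExit c F₀ j₀)
    (hadj : ∀ p ∈ latPieces v₀ l, p.1 = p.2 ∨ triGraph.Adj p.1 p.2) {L₁ L₂ : List (Site 2 × Site 2)}
    (hL : latPieces v₀ l = L₁ ++ (faceVertex F₀ (j₀ + 1), faceVertex F₀ (j₀ + 2)) :: L₂ ∨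
      latPieces v₀ l = L₁ ++ (faceVertex F₀ (j₀ + 2), faceVertex F₀ (j₀ + 1)) :: L₂)
    (hrest : ∀ p ∈ L₁ ++ L₂, ¬ ((p.1 = faceVertex F₀ (j₀ + 1) ∧ p.2 = faceVertex F₀ (j₀ + 2)) ∨
      (p.1 = faceVertex F₀ (j₀ + 2) ∧ p.2 = faceVertex F₀ (j₀ + 1)))) :
    latWind v₀ l (hexCenter (walk c F₀ 1)) ≠ latWind v₀ l (hexCenter F₀) := by
  rw [walk_one hX₀]
  exact (latWind_hexCenter_ne_of_side hadj hL hrest).symm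

/-- **A vertex of a face of the walk which is not a vertex of a piece has the winding number of
the first face.** [cite: BollobasRiordan2006, Ch. 7 proof of Claim 9 p. 175 ("every site of N(P') is on or inside C")] -/
theorem latWind_triEmbed_eq_walk_one (h : ∃ t, next c (walk c F₀ t) = none) (h₀ : ∀ j, ¬ IsEntry c F₀ j) (hX₀ : IsExit c F₀ j₀)
    (hadj : ∀ p ∈ latPieces v₀ l, p.1 = p.2 ∨ triGraph.Adj p.1 p.2)
    (hmono : ∀ p ∈ latPieces v₀ l,
      ¬ ((p.1 = faceVertex F₀ (j₀ + 1) ∧ p.2 = faceVertex F₀ (j₀ + 2)) ∨ (p.1 = faceVertex F₀ (j₀ + 2) ∧ p.2 = faceVertex F₀ (j₀ + 1))) →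
        ∀ b₁ b₂, c p.1 = some b₁ → c p.2 = some b₂ → b₁ = b₂)
    {t : ℕ} (h1 : 1 ≤ t) (ht : t ≤ len c F₀) {x : Site 2} (hx : x ∈ hexFaceVertices (walk c F₀ t))
    (hne : ∀ p ∈ latPieces v₀ l, x ≠ p.1 ∧ x ≠ p.2) :
    latWind v₀ l (triEmbed x) = latWind v₀ l (hexCenter (walk c F₀ 1)) := by
  rw [← latWind_hexCenter_eq_of_mem_hexFaceVertices hadj hx hne]
  exact latWind_walk_eq h h₀ hX₀ hadj hmono h1 ht

end SiteIface

/-! ### The hexagonal ring `∂Λ_k` in anticlockwise order -/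

/-- **The `i`-th site of the hexagon `∂Λ_k`, anticlockwise from the corner `(k, -k)`**: the
sides `x₀ = k` (`i ≤ k`), `x₀ + x₁ = k` (`k ≤ i ≤ 2k`), `x₁ = k`, `x₀ = -k`, `x₀ + x₁ = -k`,
`x₁ = -k` (`5k ≤ i`; beyond `6k` the last side is continued, junk). [folklore] -/
def ringPt (k i : ℕ) : Site 2 :=
  if i ≤ k then ![(k : ℤ), (i : ℤ) - k]
  else if i ≤ 2 * k then ![2 * (k : ℤ) - i, (i : ℤ) - k]
  else if i ≤ 3 * k then ![2 * (k : ℤ) - i, (k : ℤ)]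
  else if i ≤ 4 * k then ![-(k : ℤ), 4 * (k : ℤ) - i]
  else if i ≤ 5 * k then ![(i : ℤ) - 5 * k, 4 * (k : ℤ) - i]
  else ![(i : ℤ) - 5 * k, -(k : ℤ)]

/-- **The coordinates of the ring sites**, side by side (the form `omega` digests). [folklore] -/
theorem ringPt_spec (k i : ℕ) :
    (i ≤ k ∧ ringPt k i 0 = k ∧ ringPt k i 1 = (i : ℤ) - k) ∨
    (k < i ∧ i ≤ 2 * k ∧ ringPt k i 0 = 2 * (k : ℤ) - i ∧ ringPt k i 1 = (i : ℤ) - k) ∨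
    (2 * k < i ∧ i ≤ 3 * k ∧ ringPt k i 0 = 2 * (k : ℤ) - i ∧ ringPt k i 1 = k) ∨
    (3 * k < i ∧ i ≤ 4 * k ∧ ringPt k i 0 = -(k : ℤ) ∧ ringPt k i 1 = 4 * (k : ℤ) - i) ∨
    (4 * k < i ∧ i ≤ 5 * k ∧ ringPt k i 0 = (i : ℤ) - 5 * k ∧ ringPt k i 1 = 4 * (k : ℤ) - i) ∨
    (5 * k < i ∧ ringPt k i 0 = (i : ℤ) - 5 * k ∧ ringPt k i 1 = -(k : ℤ)) := by
  unfold ringPt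
  split_ifs with h1 h2 h3 h4 h5
  · exact Or.inl ⟨h1, by simp, by simp⟩
  · exact Or.inr (Or.inl ⟨by omega, h2, by simp, by simp⟩)
  · exact Or.inr (Or.inr (Or.inl ⟨by omega, h3, by simp, by simp⟩))
  · exact Or.inr (Or.inr (Or.inr (Or.inl ⟨by omega, h4, by simp, by simp⟩)))
  · exact Or.inr (Or.inr (Or.inr (Or.inr (Or.inl ⟨by omega, h5, by simp, by simp⟩))))
  · exact Or.inr (Or.inr (Or.inr (Or.inr (Or.inr ⟨by omega, by simp, by simp⟩))))

/-- **Ring sites have graph norm `k`** (up to the index `6k`). [folklore] -/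
theorem triNorm_ringPt {k i : ℕ} (hi : i ≤ 6 * k) : triNorm (ringPt k i) = k := by
  have hn := triNorm_eq_of_apply_eq (y := ringPt k i) rfl rfl
  rcases ringPt_spec k i with h | h | h | h | h | h <;> omega

/-- **Consecutive ring sites are adjacent** (`k ≥ 1`). [folklore] -/
theorem ringPt_adj {k : ℕ} (hk : 1 ≤ k) (i : ℕ) : triGraph.Adj (ringPt k i) (ringPt k (i + 1)) := by
  rw [Mesh.triGraph_adj_iff_coord']
  rcases ringPt_spec k i with h | h | h | h | h | h <;> rcases ringPt_spec k (i + 1) with h' | h' | h' | h' | h' | h' <;> omega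

/-- **The ring enumeration is injective** on `[0, 6k)`. [folklore] -/
theorem ringPt_injOn {k i j : ℕ} (hi : i < 6 * k) (hj : j < 6 * k) (h : ringPt k i = ringPt k j) : i = j := by
  have h0 := congrFun h 0
  have h1 := congrFun h 1
  rcases ringPt_spec k i with h | h | h | h | h | h <;> rcases ringPt_spec k j with h' | h' | h' | h' | h' | h' <;> omega

/-- The index of the last site of the ring `∂Λ_k` on the side `x₁ = k` with `2x₀ + x₁ > 0`
(`x₀ = -⌊(k-1)/2⌋`): the tail of the bichromatic bond in the middle of that side. [folklore] -/
def ringMid (k : ℕ) : ℕ := 2 * k + (k - 1) / 2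

/-- `2k ≤ ringMid k` and `ringMid k + 1 ≤ 3k` for `k ≥ 1`. [folklore] -/
theorem ringMid_bounds {k : ℕ} (hk : 1 ≤ k) : 2 * k ≤ ringMid k ∧ ringMid k + 1 ≤ 3 * k := by
  unfold ringMid; omega

/-- **The sign of `2x₀ + x₁` along the ring**: positive exactly up to the index `ringMid k`
(for indices `≤ 5k`, `k ≥ 1`). [folklore] -/
theorem ringPt_pos_iff {k i : ℕ} (hk : 1 ≤ k) (hi : i ≤ 5 * k) : 0 < 2 * ringPt k i 0 + ringPt k i 1 ↔ i ≤ ringMid k := by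
  unfold ringMid
  rcases ringPt_spec k i with h | h | h | h | h | h <;> omega

/-- The coordinates of `ringPt k (ringMid k)` and of its successor: `(-⌊(k-1)/2⌋, k)` and
`(-⌊(k-1)/2⌋ - 1, k)`. [folklore] -/
theorem ringPt_ringMid {k : ℕ} (hk : 1 ≤ k) :
    ringPt k (ringMid k) 0 = -(((k - 1) / 2 : ℕ) : ℤ) ∧ ringPt k (ringMid k) 1 = k ∧
      ringPt k (ringMid k + 1) 0 = -(((k - 1) / 2 : ℕ) : ℤ) - 1 ∧ ringPt k (ringMid k + 1) 1 = k := by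
  obtain ⟨hb1, hb2⟩ := ringMid_bounds hk
  unfold ringMid at *
  rcases ringPt_spec k (2 * k + (k - 1) / 2) with h | h | h | h | h | h <;>
    rcases ringPt_spec k (2 * k + (k - 1) / 2 + 1) with h' | h' | h' | h' | h' | h' <;> omega

/-- **Bound `x₀ ≤ k - 1` away from the first side**: for `k + 1 ≤ i ≤ 5k`. [folklore] -/
theorem ringPt_apply_zero_le {k i : ℕ} (h1 : k + 1 ≤ i) (h2 : i ≤ 5 * k) : ringPt k i 0 ≤ (k : ℤ) - 1 := by
  rcases ringPt_spec k i with h | h | h | h | h | h <;> omega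

/-- **Bound `x₀ + x₁ ≥ -(k - 1)` before the fifth side**: for `i ≤ 4k - 1`. [folklore] -/
theorem ringPt_sum_ge {k i : ℕ} (h2 : i + 1 ≤ 4 * k) : -((k : ℤ) - 1) ≤ ringPt k i 0 + ringPt k i 1 := by
  rcases ringPt_spec k i with h | h | h | h | h | h <;> omega


/-! ### Consecutive pairs of an enumerated list -/

/-- **`consecPairs` of an enumerated list** `[f 0, …, f n]`: the pairs `(f t, f (t+1))`, `t < n`. [folklore] -/
theorem consecPairs_map_range {α : Type*} (f : ℕ → α) (n : ℕ) :
    consecPairs ((List.range (n + 1)).map f) = (List.range n).map fun t => (f t, f (t + 1)) := by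
  induction n with
  | zero => rfl
  | succ n ih =>
    rw [List.range_succ, List.map_append, List.map_singleton, List.range_succ, List.map_append, List.map_singleton,
      consecPairs_append_singleton, ← List.map_singleton, ← List.map_append, ← List.range_succ, ih, List.range_succ,
      List.map_append, List.map_singleton]

/-- Membership in the consecutive pairs of an enumerated list. [folklore] -/
theorem mem_consecPairs_map_range {α : Type*} {f : ℕ → α} {n : ℕ} {p : α × α} :
    p ∈ consecPairs ((List.range (n + 1)).map f) ↔ ∃ t < n, p = (f t, f (t + 1)) := by
  rw [consecPairs_map_range]
  simp only [List.mem_map, List.mem_range]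
  exact ⟨fun ⟨t, ht, h⟩ => ⟨t, ht, h.symm⟩, fun ⟨t, ht, h⟩ => ⟨t, ht, h.symm⟩⟩

/-- The last element of an enumerated list. [folklore] -/
theorem getLast_map_range {α : Type*} (f : ℕ → α) (n : ℕ) (h : (List.range (n + 1)).map f ≠ []) :
    ((List.range (n + 1)).map f).getLast h = f n := by
  rw [List.getLast_map, List.getLast_range]
  simp

/-- The first element of an enumerated list. [folklore] -/
theorem head_map_range {α : Type*} (f : ℕ → α) (n : ℕ) (h : (List.range (n + 1)).map f ≠ []) :
    ((List.range (n + 1)).map f).head h = f 0 := by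
  simp [List.range_succ_eq_map]

/-! ### The cycle of a sector of an annulus -/

/-- **The data of a sector cycle** (Bollobás–Riordan 2006, p. 173, the cycle `C`: "follow `P₁`
from `x₁` to `A₁`. Then follow (part of) `A₁⁺` … part of `A₂⁺`, and, finally, follow `P₂` from
`A₂` to `x₂`", adapted to an annulus `{m ≤ |·| < K}` whose outer boundary is the ring `∂Λ_K` and
whose hole is closed up through sites of norm `< m`): an arm `P` from `a` to `b` and an arm `Q`
from `a'` to `b'` inside the annulus, the anticlockwise arc of `∂Λ_K` from `ringPt K i₁ ∼ b`
through the middle `ringMid K` of the side `x₁ = K` to `ringPt K i₂ ∼ b'`, and a closing walk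
`I` through the hole from `q ∼ a'` to `q' ∼ a`. [cite: BollobasRiordan2006, Ch. 7 proof of Claim 7 p. 173] -/
structure SectorCycle where
  /-- the outer ring index -/
  K : ℕ
  /-- the inner radius of the annulus -/
  m : ℕ
  /-- inner end of the first arm -/
  a : Site 2
  /-- outer end of the first arm -/
  b : Site 2
  /-- inner end of the second arm -/
  a' : Site 2
  /-- outer end of the second arm -/
  b' : Site 2
  /-- start of the closing walk -/
  q : Site 2
  /-- end of the closing walk -/
  q' : Site 2
  /-- the first arm -/
  P : triGraph.Walk a b
  /-- the second arm -/
  Q : triGraph.Walk a' b'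
  /-- the closing walk through the hole -/
  I : triGraph.Walk q q'
  /-- first index of the arc -/
  i₁ : ℕ
  /-- last index of the arc -/
  i₂ : ℕ
  hK : 1 ≤ K
  hi₁ : i₁ ≤ ringMid K
  hi₂ : ringMid K < i₂
  hi₂' : i₂ ≤ 5 * K
  adj₁ : triGraph.Adj b (ringPt K i₁)
  adj₂ : triGraph.Adj (ringPt K i₂) b'
  adjq : triGraph.Adj a' q
  adjq' : triGraph.Adj q' a
  P_norm : ∀ x ∈ P.support, (m : ℤ) ≤ triNorm x ∧ triNorm x < K
  Q_norm : ∀ x ∈ Q.support, (m : ℤ) ≤ triNorm x ∧ triNorm x < K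
  I_norm : ∀ x ∈ I.support, triNorm x < m

namespace SectorCycle

variable (C : SectorCycle)

/-- The arc up to the middle: `ringPt K i₁, …, ringPt K (ringMid K)`. [folklore] -/
def arcB : List (Site 2) := (List.range (ringMid C.K - C.i₁ + 1)).map fun t => ringPt C.K (C.i₁ + t)

/-- The arc after the middle: `ringPt K (ringMid K + 1), …, ringPt K i₂`. [folklore] -/
def arcW : List (Site 2) := (List.range (C.i₂ - ringMid C.K - 1 + 1)).map fun t => ringPt C.K (ringMid C.K + 1 + t)

/-- The points of the cycle after `a`: `P` (without `a`), the two arcs, `Q` reversed, `I`. [folklore] -/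
def pts : List (Site 2) := C.P.support.tail ++ C.arcB ++ C.arcW ++ C.Q.reverse.support ++ C.I.support

/-- **The winding number of the sector cycle** about a point. [cite: BollobasRiordan2006, Ch. 7 proof of Claim 7 p. 173] -/
def W (p : ℂ) : ℤ := latWind C.a C.pts p

/-- `arcB` is nonempty. [folklore] -/
theorem arcB_ne_nil : C.arcB ≠ [] := by unfold arcB; simp

/-- `arcW` is nonempty. [folklore] -/
theorem arcW_ne_nil : C.arcW ≠ [] := by unfold arcW; simp

/-- The first site of `arcB`. [folklore] -/
theorem arcB_head : C.arcB.head C.arcB_ne_nil = ringPt C.K C.i₁ := by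
  unfold arcB; rw [head_map_range]; rfl

/-- The last site of `arcB` is the middle site. [folklore] -/
theorem arcB_getLast : C.arcB.getLast C.arcB_ne_nil = ringPt C.K (ringMid C.K) := by
  unfold arcB; rw [getLast_map_range]; have := C.hi₁; congr 1; omega

/-- The first site of `arcW` is the site after the middle. [folklore] -/
theorem arcW_head : C.arcW.head C.arcW_ne_nil = ringPt C.K (ringMid C.K + 1) := by
  unfold arcW; rw [head_map_range]

/-- The last site of `arcW`. [folklore] -/
theorem arcW_getLast : C.arcW.getLast C.arcW_ne_nil = ringPt C.K C.i₂ := by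
  unfold arcW; rw [getLast_map_range]; have := C.hi₂; congr 1; omega

/-- Members of `arcB` are ring sites with index in `[i₁, ringMid K]`. [folklore] -/
theorem mem_arcB_iff {x : Site 2} : x ∈ C.arcB ↔ ∃ i, C.i₁ ≤ i ∧ i ≤ ringMid C.K ∧ ringPt C.K i = x := by
  unfold arcB
  simp only [List.mem_map, List.mem_range]
  have := C.hi₁
  constructor
  · rintro ⟨t, ht, rfl⟩; exact ⟨C.i₁ + t, by omega, by omega, rfl⟩
  · rintro ⟨i, h1, h2, rfl⟩; exact ⟨i - C.i₁, by omega, by congr 1; omega⟩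

/-- Members of `arcW` are ring sites with index in `[ringMid K + 1, i₂]`. [folklore] -/
theorem mem_arcW_iff {x : Site 2} : x ∈ C.arcW ↔ ∃ i, ringMid C.K + 1 ≤ i ∧ i ≤ C.i₂ ∧ ringPt C.K i = x := by
  unfold arcW
  simp only [List.mem_map, List.mem_range]
  have := C.hi₂
  constructor
  · rintro ⟨t, ht, rfl⟩; exact ⟨ringMid C.K + 1 + t, by omega, by omega, rfl⟩
  · rintro ⟨i, h1, h2, rfl⟩; exact ⟨i - (ringMid C.K + 1), by omega, by congr 1; omega⟩

/-- The consecutive pairs of `arcB`. [folklore] -/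
theorem mem_consecPairs_arcB {p : Site 2 × Site 2} (hp : p ∈ consecPairs C.arcB) :
    ∃ i, C.i₁ ≤ i ∧ i < ringMid C.K ∧ p = (ringPt C.K i, ringPt C.K (i + 1)) := by
  unfold arcB at hp
  obtain ⟨t, ht, rfl⟩ := mem_consecPairs_map_range.1 hp
  have := C.hi₁
  exact ⟨C.i₁ + t, by omega, by omega, Prod.ext rfl (congrArg (ringPt C.K) (by omega))⟩

/-- The consecutive pairs of `arcW`. [folklore] -/
theorem mem_consecPairs_arcW {p : Site 2 × Site 2} (hp : p ∈ consecPairs C.arcW) :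
    ∃ i, ringMid C.K + 1 ≤ i ∧ i < C.i₂ ∧ p = (ringPt C.K i, ringPt C.K (i + 1)) := by
  unfold arcW at hp
  obtain ⟨t, ht, rfl⟩ := mem_consecPairs_map_range.1 hp
  have := C.hi₂
  exact ⟨ringMid C.K + 1 + t, by omega, by omega, Prod.ext rfl (congrArg (ringPt C.K) (by omega))⟩

/-- The cyclic list of points of the cycle. [folklore] -/
theorem cons_pts_append : C.a :: C.pts ++ [C.a] =
    C.P.support ++ (C.arcB ++ (C.arcW ++ (C.Q.reverse.support ++ (C.I.support ++ [C.a])))) := by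
  unfold pts
  rw [← C.P.cons_tail_support]
  simp only [List.tail_cons, List.cons_append, List.append_assoc]

/-- **The pieces of the cycle**: the bonds of `P`, the bond `(b, ringPt K i₁)`, the bonds of the
arc before the middle, the middle bond `(ringPt K (ringMid K), ringPt K (ringMid K + 1))`, the
bonds of the arc after it, the bond `(ringPt K i₂, b')`, the bonds of `Q` reversed, the bond
`(a', q)`, the bonds of `I`, and the bond `(q', a)`. [folklore] -/
theorem latPieces_eq : latPieces C.a C.pts =
    consecPairs C.P.support ++ (C.b, ringPt C.K C.i₁) :: (consecPairs C.arcB ++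
      (ringPt C.K (ringMid C.K), ringPt C.K (ringMid C.K + 1)) :: (consecPairs C.arcW ++ (ringPt C.K C.i₂, C.b') ::
        (consecPairs C.Q.reverse.support ++ (C.a', C.q) :: (consecPairs C.I.support ++ [(C.q', C.a)])))) := by
  rw [latPieces_eq_consecPairs, C.cons_pts_append,
    consecPairs_append_of_ne_nil _ _ (SimpleGraph.Walk.support_ne_nil _) (by simp [C.arcB_ne_nil]),
    consecPairs_append_of_ne_nil _ _ C.arcB_ne_nil (by simp [C.arcW_ne_nil]),
    consecPairs_append_of_ne_nil _ _ C.arcW_ne_nil (by simp),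
    consecPairs_append_of_ne_nil _ _ (SimpleGraph.Walk.support_ne_nil _) (by simp),
    consecPairs_append_of_ne_nil _ _ (SimpleGraph.Walk.support_ne_nil _) (by simp)]
  have h1 : (C.arcB ++ (C.arcW ++ (C.Q.reverse.support ++ (C.I.support ++ [C.a])))).head (by simp [C.arcB_ne_nil]) = ringPt C.K C.i₁ := by
    rw [List.head_append_of_ne_nil C.arcB_ne_nil, C.arcB_head]
  have h2 : (C.arcW ++ (C.Q.reverse.support ++ (C.I.support ++ [C.a]))).head (by simp [C.arcW_ne_nil]) = ringPt C.K (ringMid C.K + 1) := by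
    rw [List.head_append_of_ne_nil C.arcW_ne_nil, C.arcW_head]
  have h3 : (C.Q.reverse.support ++ (C.I.support ++ [C.a])).head (by simp) = C.b' := by
    rw [List.head_append_of_ne_nil (SimpleGraph.Walk.support_ne_nil _), SimpleGraph.Walk.head_support]
  have h4 : (C.I.support ++ [C.a]).head (by simp) = C.q := by
    rw [List.head_append_of_ne_nil (SimpleGraph.Walk.support_ne_nil _), SimpleGraph.Walk.head_support]
  simp only [SimpleGraph.Walk.getLast_support, consecPairs_singleton, List.head_cons, C.arcB_getLast, C.arcW_getLast, h1, h2, h3, h4]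

/-- Membership in the pieces of the cycle. [folklore] -/
theorem mem_latPieces {p : Site 2 × Site 2} (hp : p ∈ latPieces C.a C.pts) :
    p ∈ consecPairs C.P.support ∨ p = (C.b, ringPt C.K C.i₁) ∨ p ∈ consecPairs C.arcB ∨
      p = (ringPt C.K (ringMid C.K), ringPt C.K (ringMid C.K + 1)) ∨ p ∈ consecPairs C.arcW ∨ p = (ringPt C.K C.i₂, C.b') ∨
      p ∈ consecPairs C.Q.reverse.support ∨ p = (C.a', C.q) ∨ p ∈ consecPairs C.I.support ∨ p = (C.q', C.a) := by
  rw [C.latPieces_eq] at hp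
  simp only [List.mem_append, List.mem_cons, List.not_mem_nil, or_false] at hp
  tauto

/-- **Every piece of the cycle is a bond or a point.** [folklore] -/
theorem fst_eq_or_adj_of_mem_latPieces {p : Site 2 × Site 2} (hp : p ∈ latPieces C.a C.pts) :
    p.1 = p.2 ∨ triGraph.Adj p.1 p.2 := by
  rcases C.mem_latPieces hp with h | rfl | h | rfl | h | rfl | h | rfl | h | rfl
  · exact Or.inr (adj_of_mem_consecPairs_support _ h)
  · exact Or.inr C.adj₁
  · obtain ⟨i, -, -, rfl⟩ := C.mem_consecPairs_arcB h
    exact Or.inr (ringPt_adj C.hK i)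
  · exact Or.inr (ringPt_adj C.hK _)
  · obtain ⟨i, -, -, rfl⟩ := C.mem_consecPairs_arcW h
    exact Or.inr (ringPt_adj C.hK i)
  · exact Or.inr C.adj₂
  · exact Or.inr (adj_of_mem_consecPairs_support _ h)
  · exact Or.inr C.adjq
  · exact Or.inr (adj_of_mem_consecPairs_support _ h)
  · exact Or.inr C.adjq'

/-- `m < K` (the first arm starts in the annulus). [folklore] -/
theorem m_lt_K : (C.m : ℤ) < C.K := by
  have := C.P_norm C.a C.P.start_mem_support
  omega

/-- **The vertices of the cycle have graph norm `≤ K`.** [folklore] -/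
theorem triNorm_le_of_mem {v : Site 2} (hv : v ∈ C.a :: C.pts) : triNorm v ≤ C.K := by
  have hm := C.m_lt_K
  unfold pts at hv
  simp only [List.mem_cons, List.mem_append, SimpleGraph.Walk.support_reverse, List.mem_reverse, or_assoc] at hv
  rcases hv with rfl | hv | hv | hv | hv | hv
  · exact (C.P_norm _ C.P.start_mem_support).2.le
  · exact (C.P_norm _ (List.mem_of_mem_tail hv)).2.le
  · obtain ⟨i, -, h2, rfl⟩ := C.mem_arcB_iff.1 hv
    have := C.hi₂; have := C.hi₂'
    rw [triNorm_ringPt (by omega)]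
  · obtain ⟨i, -, h2, rfl⟩ := C.mem_arcW_iff.1 hv
    have := C.hi₂'
    rw [triNorm_ringPt (by omega)]
  · exact (C.Q_norm _ hv).2.le
  · have := C.I_norm _ hv; omega

/-- **No winding about sites beyond the ring.** [folklore] -/
theorem W_triEmbed_eq_zero_of_lt {z : Site 2} (hz : (C.K : ℤ) < triNorm z) : C.W (triEmbed z) = 0 :=
  latWind_triEmbed_eq_zero_of_triNorm_lt (fun _ hv => C.triNorm_le_of_mem hv) hz

/-- **The endpoints of the pieces**: on `P`, on `Q`, on the ring `∂Λ_K`, or in the hole. [folklore] -/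
theorem endpoints_of_mem_latPieces {p : Site 2 × Site 2} (hp : p ∈ latPieces C.a C.pts) :
    (p.1 ∈ C.P.support ∨ p.1 ∈ C.Q.support ∨ triNorm p.1 = C.K ∨ triNorm p.1 < C.m) ∧
      (p.2 ∈ C.P.support ∨ p.2 ∈ C.Q.support ∨ triNorm p.2 = C.K ∨ triNorm p.2 < C.m) := by
  have hi₂' := C.hi₂'; have hi₂ := C.hi₂; have hi₁ := C.hi₁
  have hring : ∀ i ≤ C.i₂, triNorm (ringPt C.K i) = C.K := fun i hi => triNorm_ringPt (by omega)
  rcases C.mem_latPieces hp with h | rfl | h | rfl | h | rfl | h | rfl | h | rfl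
  · obtain ⟨h1, h2⟩ := mem_of_mem_consecPairs h
    exact ⟨Or.inl h1, Or.inl h2⟩
  · exact ⟨Or.inl C.P.end_mem_support, Or.inr (Or.inr (Or.inl (hring _ (by omega))))⟩
  · obtain ⟨i, -, hi, rfl⟩ := C.mem_consecPairs_arcB h
    exact ⟨Or.inr (Or.inr (Or.inl (hring _ (by omega)))), Or.inr (Or.inr (Or.inl (hring _ (by omega))))⟩
  · exact ⟨Or.inr (Or.inr (Or.inl (hring _ (by omega)))), Or.inr (Or.inr (Or.inl (hring _ (by omega))))⟩
  · obtain ⟨i, -, hi, rfl⟩ := C.mem_consecPairs_arcW h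
    exact ⟨Or.inr (Or.inr (Or.inl (hring _ (by omega)))), Or.inr (Or.inr (Or.inl (hring _ (by omega))))⟩
  · exact ⟨Or.inr (Or.inr (Or.inl (hring _ le_rfl))), Or.inr (Or.inl C.Q.end_mem_support)⟩
  · obtain ⟨h1, h2⟩ := mem_of_mem_consecPairs h
    rw [SimpleGraph.Walk.support_reverse, List.mem_reverse] at h1 h2
    exact ⟨Or.inr (Or.inl h1), Or.inr (Or.inl h2)⟩
  · exact ⟨Or.inr (Or.inl C.Q.start_mem_support), Or.inr (Or.inr (Or.inr (C.I_norm _ C.I.start_mem_support)))⟩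
  · obtain ⟨h1, h2⟩ := mem_of_mem_consecPairs h
    exact ⟨Or.inr (Or.inr (Or.inr (C.I_norm _ h1))), Or.inr (Or.inr (Or.inr (C.I_norm _ h2)))⟩
  · exact ⟨Or.inr (Or.inr (Or.inr (C.I_norm _ C.I.end_mem_support))), Or.inl C.P.start_mem_support⟩

/-- **The endpoints of the pieces, with the arc indices.** [folklore] -/
theorem endpoints_of_mem_latPieces' {p : Site 2 × Site 2} (hp : p ∈ latPieces C.a C.pts) :
    (p.1 ∈ C.P.support ∨ p.1 ∈ C.Q.support ∨ (∃ i, C.i₁ ≤ i ∧ i ≤ C.i₂ ∧ p.1 = ringPt C.K i) ∨ triNorm p.1 < C.m) ∧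
      (p.2 ∈ C.P.support ∨ p.2 ∈ C.Q.support ∨ (∃ i, C.i₁ ≤ i ∧ i ≤ C.i₂ ∧ p.2 = ringPt C.K i) ∨ triNorm p.2 < C.m) := by
  have hi₂' := C.hi₂'; have hi₂ := C.hi₂; have hi₁ := C.hi₁
  have hring : ∀ i, C.i₁ ≤ i → i ≤ C.i₂ → ∃ i', C.i₁ ≤ i' ∧ i' ≤ C.i₂ ∧ ringPt C.K i = ringPt C.K i' :=
    fun i h1 h2 => ⟨i, h1, h2, rfl⟩
  rcases C.mem_latPieces hp with h | rfl | h | rfl | h | rfl | h | rfl | h | rfl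
  · obtain ⟨h1, h2⟩ := mem_of_mem_consecPairs h
    exact ⟨Or.inl h1, Or.inl h2⟩
  · exact ⟨Or.inl C.P.end_mem_support, Or.inr (Or.inr (Or.inl (hring _ le_rfl (by omega))))⟩
  · obtain ⟨i, hi, hi', rfl⟩ := C.mem_consecPairs_arcB h
    exact ⟨Or.inr (Or.inr (Or.inl (hring _ hi (by omega)))), Or.inr (Or.inr (Or.inl (hring _ (by omega) (by omega))))⟩
  · exact ⟨Or.inr (Or.inr (Or.inl (hring _ hi₁ (by omega)))), Or.inr (Or.inr (Or.inl (hring _ (by omega) (by omega))))⟩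
  · obtain ⟨i, hi, hi', rfl⟩ := C.mem_consecPairs_arcW h
    exact ⟨Or.inr (Or.inr (Or.inl (hring _ (by omega) (by omega)))), Or.inr (Or.inr (Or.inl (hring _ (by omega) (by omega))))⟩
  · exact ⟨Or.inr (Or.inr (Or.inl (hring _ (by omega) le_rfl))), Or.inr (Or.inl C.Q.end_mem_support)⟩
  · obtain ⟨h1, h2⟩ := mem_of_mem_consecPairs h
    rw [SimpleGraph.Walk.support_reverse, List.mem_reverse] at h1 h2
    exact ⟨Or.inr (Or.inl h1), Or.inr (Or.inl h2)⟩
  · exact ⟨Or.inr (Or.inl C.Q.start_mem_support), Or.inr (Or.inr (Or.inr (C.I_norm _ C.I.start_mem_support)))⟩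
  · obtain ⟨h1, h2⟩ := mem_of_mem_consecPairs h
    exact ⟨Or.inr (Or.inr (Or.inr (C.I_norm _ h1))), Or.inr (Or.inr (Or.inr (C.I_norm _ h2)))⟩
  · exact ⟨Or.inr (Or.inr (Or.inr (C.I_norm _ C.I.end_mem_support))), Or.inl C.P.start_mem_support⟩

/-- **A site off the two arms, off the arc and outside the hole is not a vertex of any piece.** [folklore] -/
theorem ne_of_mem_latPieces' {x : Site 2} (hxP : x ∉ C.P.support) (hxQ : x ∉ C.Q.support)
    (hxm : (C.m : ℤ) ≤ triNorm x) (hxr : ∀ i, C.i₁ ≤ i → i ≤ C.i₂ → x ≠ ringPt C.K i) :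
    ∀ p ∈ latPieces C.a C.pts, x ≠ p.1 ∧ x ≠ p.2 := by
  intro p hp
  obtain ⟨h1, h2⟩ := C.endpoints_of_mem_latPieces' hp
  constructor
  · rintro rfl
    rcases h1 with h | h | ⟨i, hi, hi', h⟩ | h
    · exact hxP h
    · exact hxQ h
    · exact hxr i hi hi' h
    · omega
  · rintro rfl
    rcases h2 with h | h | ⟨i, hi, hi', h⟩ | h
    · exact hxP h
    · exact hxQ h
    · exact hxr i hi hi' h
    · omega

/-- **A site of the annulus off the two arms is not a vertex of any piece.** [folklore] -/
theorem ne_of_mem_latPieces {x : Site 2} (hxP : x ∉ C.P.support) (hxQ : x ∉ C.Q.support)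
    (hxm : (C.m : ℤ) ≤ triNorm x) (hxK : triNorm x ≠ C.K) :
    ∀ p ∈ latPieces C.a C.pts, x ≠ p.1 ∧ x ≠ p.2 := by
  intro p hp
  obtain ⟨h1, h2⟩ := C.endpoints_of_mem_latPieces hp
  constructor
  · rintro rfl
    rcases h1 with h | h | h | h
    · exact hxP h
    · exact hxQ h
    · exact hxK h
    · omega
  · rintro rfl
    rcases h2 with h | h | h | h
    · exact hxP h
    · exact hxQ h
    · exact hxK h
    · omega

/-- The pieces other than the middle bond. [folklore] -/
def rest : List (Site 2 × Site 2) :=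
  (consecPairs C.P.support ++ (C.b, ringPt C.K C.i₁) :: consecPairs C.arcB) ++
    (consecPairs C.arcW ++ (ringPt C.K C.i₂, C.b') ::
      (consecPairs C.Q.reverse.support ++ (C.a', C.q) :: (consecPairs C.I.support ++ [(C.q', C.a)])))

/-- **The pieces with the middle bond singled out.** [folklore] -/
theorem latPieces_eq_mid : latPieces C.a C.pts =
    (consecPairs C.P.support ++ (C.b, ringPt C.K C.i₁) :: consecPairs C.arcB) ++
      (ringPt C.K (ringMid C.K), ringPt C.K (ringMid C.K + 1)) ::
        (consecPairs C.arcW ++ (ringPt C.K C.i₂, C.b') ::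
          (consecPairs C.Q.reverse.support ++ (C.a', C.q) :: (consecPairs C.I.support ++ [(C.q', C.a)]))) := by
  rw [C.latPieces_eq]; simp

/-- Members of `rest` are pieces. [folklore] -/
theorem mem_latPieces_of_mem_rest {p : Site 2 × Site 2} (hp : p ∈ C.rest) : p ∈ latPieces C.a C.pts := by
  rw [C.latPieces_eq_mid]
  unfold rest at hp
  simp only [List.mem_append, List.mem_cons] at hp ⊢
  tauto

/-- Members of `rest`, case by case. [folklore] -/
theorem mem_rest_cases {p : Site 2 × Site 2} (hp : p ∈ C.rest) :
    p ∈ consecPairs C.P.support ∨ p = (C.b, ringPt C.K C.i₁) ∨ p ∈ consecPairs C.arcB ∨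
      p ∈ consecPairs C.arcW ∨ p = (ringPt C.K C.i₂, C.b') ∨
      p ∈ consecPairs C.Q.reverse.support ∨ p = (C.a', C.q) ∨ p ∈ consecPairs C.I.support ∨ p = (C.q', C.a) := by
  unfold rest at hp
  simp only [List.mem_append, List.mem_cons, List.not_mem_nil, or_false] at hp
  tauto

/-- **No piece other than the middle bond has the endpoints of the middle bond.** [folklore] -/
theorem ne_mid_of_mem_rest {p : Site 2 × Site 2} (hp : p ∈ C.rest) :
    ¬ ((p.1 = ringPt C.K (ringMid C.K) ∧ p.2 = ringPt C.K (ringMid C.K + 1)) ∨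
      (p.1 = ringPt C.K (ringMid C.K + 1) ∧ p.2 = ringPt C.K (ringMid C.K))) := by
  have hi₂' := C.hi₂'; have hi₂ := C.hi₂; have hi₁ := C.hi₁; have hK := C.hK; have hmK := C.m_lt_K
  have hmid : triNorm (ringPt C.K (ringMid C.K)) = C.K := triNorm_ringPt (by omega)
  have hmid' : triNorm (ringPt C.K (ringMid C.K + 1)) = C.K := triNorm_ringPt (by omega)
  -- an endpoint of norm `≠ K` rules out both alternatives
  have key1 : triNorm p.1 ≠ C.K → ¬ ((p.1 = ringPt C.K (ringMid C.K) ∧ p.2 = ringPt C.K (ringMid C.K + 1)) ∨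
      (p.1 = ringPt C.K (ringMid C.K + 1) ∧ p.2 = ringPt C.K (ringMid C.K))) := by
    rintro hne (⟨h1, -⟩ | ⟨h1, -⟩)
    · exact hne (by rw [h1, hmid])
    · exact hne (by rw [h1, hmid'])
  have key2 : triNorm p.2 ≠ C.K → ¬ ((p.1 = ringPt C.K (ringMid C.K) ∧ p.2 = ringPt C.K (ringMid C.K + 1)) ∨
      (p.1 = ringPt C.K (ringMid C.K + 1) ∧ p.2 = ringPt C.K (ringMid C.K))) := by
    rintro hne (⟨-, h2⟩ | ⟨-, h2⟩)
    · exact hne (by rw [h2, hmid'])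
    · exact hne (by rw [h2, hmid])
  have hPK : ∀ x ∈ C.P.support, triNorm x ≠ C.K := fun x hx => (C.P_norm x hx).2.ne
  have hQK : ∀ x ∈ C.Q.support, triNorm x ≠ C.K := fun x hx => (C.Q_norm x hx).2.ne
  have hIK : ∀ x ∈ C.I.support, triNorm x ≠ C.K := fun x hx => by have := C.I_norm x hx; omega
  -- arc pieces: by injectivity of the enumeration
  have harc : ∀ i, i < C.i₂ → i ≠ ringMid C.K → ¬ ((ringPt C.K i = ringPt C.K (ringMid C.K) ∧ ringPt C.K (i + 1) = ringPt C.K (ringMid C.K + 1)) ∨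
      (ringPt C.K i = ringPt C.K (ringMid C.K + 1) ∧ ringPt C.K (i + 1) = ringPt C.K (ringMid C.K))) := by
    rintro i hi hne (⟨h1, -⟩ | ⟨h1, h2⟩)
    · exact hne (ringPt_injOn (by omega) (by omega) h1)
    · have e1 := ringPt_injOn (k := C.K) (by omega) (by omega) h1
      have e2 := ringPt_injOn (k := C.K) (by omega) (by omega) h2
      omega
  rcases C.mem_rest_cases hp with h | rfl | h | h | rfl | h | rfl | h | rfl
  · exact key1 (hPK _ (mem_of_mem_consecPairs h).1)
  · exact key1 (hPK _ C.P.end_mem_support)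
  · obtain ⟨i, -, hi, rfl⟩ := C.mem_consecPairs_arcB h
    exact harc i (by omega) (by omega)
  · obtain ⟨i, hi, hi', rfl⟩ := C.mem_consecPairs_arcW h
    exact harc i hi' (by omega)
  · exact key2 (hQK _ C.Q.end_mem_support)
  · have h1 := (mem_of_mem_consecPairs h).1
    rw [SimpleGraph.Walk.support_reverse, List.mem_reverse] at h1
    exact key1 (hQK _ h1)
  · exact key1 (hQK _ C.Q.start_mem_support)
  · exact key1 (hIK _ (mem_of_mem_consecPairs h).1)
  · exact key2 (hPK _ C.P.start_mem_support)

/-- **The colours of the pieces other than the middle bond**: for a colouring which is `some true`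
on `P`, `some false` on `Q`, grey in the hole, and `some (i ≤ ringMid K)` at `ringPt K i` along the
ring, every piece other than the middle bond joins two sites of the same colour or has a grey
endpoint. [cite: BollobasRiordan2006, Ch. 7 proof of Claim 7 p. 174 ("no edge of I can cross C")] -/
theorem colours_of_mem_latPieces {c : Site 2 → Option Bool} (hP : ∀ x ∈ C.P.support, c x = some true)
    (hQ : ∀ x ∈ C.Q.support, c x = some false) (hI : ∀ x ∈ C.I.support, c x = none)
    (hring : ∀ i ≤ 5 * C.K, c (ringPt C.K i) = some (decide (i ≤ ringMid C.K)))
    {p : Site 2 × Site 2} (hp : p ∈ latPieces C.a C.pts)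
    (hne : ¬ ((p.1 = ringPt C.K (ringMid C.K) ∧ p.2 = ringPt C.K (ringMid C.K + 1)) ∨
      (p.1 = ringPt C.K (ringMid C.K + 1) ∧ p.2 = ringPt C.K (ringMid C.K))))
    (b₁ b₂ : Bool) (h1 : c p.1 = some b₁) (h2 : c p.2 = some b₂) : b₁ = b₂ := by
  have hi₂' := C.hi₂'; have hi₂ := C.hi₂; have hi₁ := C.hi₁
  have same : ∀ {x y : Site 2} {b : Bool}, c x = some b → c y = some b → p = (x, y) → b₁ = b₂ := by
    rintro x y b hx hy rfl
    rw [hx] at h1; rw [hy] at h2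
    simp only [Option.some.injEq] at h1 h2
    rw [← h1, ← h2]
  rcases C.mem_latPieces hp with h | rfl | h | rfl | h | rfl | h | rfl | h | rfl
  · obtain ⟨m1, m2⟩ := mem_of_mem_consecPairs h
    exact same (hP _ m1) (hP _ m2) rfl
  · refine same (hP _ C.P.end_mem_support) ?_ rfl
    rw [hring _ (by omega)]; simp [hi₁]
  · obtain ⟨i, hi, hi', rfl⟩ := C.mem_consecPairs_arcB h
    refine same (b := true) ?_ ?_ rfl
    · rw [hring _ (by omega)]; simp; omega
    · rw [hring _ (by omega)]; simp; omega
  · exact absurd (Or.inl ⟨rfl, rfl⟩) hne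
  · obtain ⟨i, hi, hi', rfl⟩ := C.mem_consecPairs_arcW h
    refine same (b := false) ?_ ?_ rfl
    · rw [hring _ (by omega)]; simp; omega
    · rw [hring _ (by omega)]; simp; omega
  · refine same ?_ (hQ _ C.Q.end_mem_support) rfl
    rw [hring _ hi₂']; simp; omega
  · obtain ⟨m1, m2⟩ := mem_of_mem_consecPairs h
    rw [SimpleGraph.Walk.support_reverse, List.mem_reverse] at m1 m2
    exact same (hQ _ m1) (hQ _ m2) rfl
  · have := hI _ C.I.start_mem_support
    change c C.q = some b₂ at h2
    rw [this] at h2; exact absurd h2 (by simp)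
  · have := hI _ (mem_of_mem_consecPairs h).1
    rw [this] at h1; exact absurd h1 (by simp)
  · have := hI _ C.I.end_mem_support
    change c C.q' = some b₁ at h1
    rw [this] at h1; exact absurd h1 (by simp)

end SectorCycle

end Literature.Probability.Percolation

end
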